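import Literature.Computability.Complexity.UmansFPDecode
import Literature.Computability.Complexity.UmansWalk
import HarnessLib

/-!
# Umans' generator, machine level XI: the walk of §6.3 on tables

Literature / circuit complexity — derandomization. Machine side of `UmansWalk.lean` (C. Umans, JCSS
2003, §6.3): the levels (`runLevel`), the phases with their jumps (`phase`), the walk (`walk`) and
the reconstruction (`reconstruct`) are written as programs on TABLES (value functions `K → L` as
lists of `L`-lists, `UmansFPDecode.lean`), with the interleaved learning step `stepL`, the predictor
program `gL` and the automorphism `σ` on `L`-lists `sL` as list-function parameters, and proved to
REPRESENT the mathematical walk state by state: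

* `lastWinL`, `runLevelL`, `sigTab`, `phaseL`, `walkL`, `reconstructL`;
* representation relations `TabOKq` (a table of `q` rows representing a value function),
  `PairListOK`, `WinOK`, `StateOK`;
* `runLevelL_ok`, `phaseL_ok`, `walkL_ok`, **`reconstructL_ok`**: under the hypotheses of
  `stepL_spec` at every level (faithful predictor and coordinates, Sudan's numeric hypotheses, node
  lists `bn` listing the reference nodes `b(e, ·)`), a faithful `sL`, digits `< q` and enough steps
  per level, the programs represent `X.runLevel`, `X.phase`, `X.walk`, and `ρ (reconstructL …) =
  X.reconstruct …`.

Everything is proved; no named fact. The `CodeFP` certificates are in the next file.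

## References

* C. Umans, *Pseudo-random generators for all hardnesses*, JCSS 67 (2003), §6.3, Thm. 14 [Umans2003].
-/

noncomputable section

namespace Literature.Computability.Complexity

open Polynomial Literature.InformationTheory.Coding
open Literature.InformationTheory.Coding.GF2X CodeFP

namespace UmansFP

/-! ### The programs -/

/-- A table (list of `L`-lists indexed by the bitmask of the argument). [folklore] -/
abbrev Tab : Type := List (List ℕ)

/-- **The last windows** of a list of learned table pairs: its last `n₀` entries, split.
[cite: Umans2003, §6.3] -/
def lastWinL (n₀ : ℕ) (l : List (Tab × Tab)) : List Tab × List Tab :=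
  let t := l.drop (l.length - n₀)
  (t.map Prod.fst, t.map Prod.snd)

/-- **`T` successive interleaved learning steps at level `cl`** on tables (node lists `bn`: row `e`
lists the nodes `b(e, ·)`; the step uses rows `d - cl` and `0`). [cite: Umans2003, §6.3] -/
def runLevelL (c : ℕ × ℕ × ℕ) (q I J D A cap d n₀ : ℕ) (gL : List (List ℕ) → List (List ℕ)) (bn : List (List ℕ))
    (cl : ℕ) (init : List (Tab × Tab)) (T : ℕ) : List (Tab × Tab) :=
  (List.replicate T ()).foldl (fun l _ =>
    l ++ [stepL c q I J D A cap d n₀ gL (bn.getD (d - cl) []) (bn.getD 0 []) (lastWinL n₀ l).1 (lastWinL n₀ l).2]) init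

/-- The automorphism applied to every entry of a table. [cite: Umans2003, §6.3] -/
def sigTab (sL : List ℕ → List ℕ) (T : Tab) : Tab := T.map sL

/-- **Clamping a table** to `q` rows of at most `B` entries, each at most `2ᵂ` (the identity on
valid tables; makes the sizes of the walk's state unconditionally polynomial). [folklore] -/
def clampTab (W B q : ℕ) (T : Tab) : Tab := (T.take q).map fun r => (r.take B).map fun x => min x (2 ^ W)

/-- The state between phases: base offset (binary) and the two windows (lists of `n₀` tables). [folklore] -/
abbrev WStateL : Type := ℕ × List Tab × List Tab

/-- **One phase at level `cl` with digit `w`** on tables: run `T` steps, then jump (new base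
`(a + w) q' mod P`, new windows `σ` of the tables learned at the offsets `w + (k+1) q`).
[cite: Umans2003, §6.3] -/
def phaseL (c : ℕ × ℕ × ℕ) (q I J D A cap d n₀ : ℕ) (gL : List (List ℕ) → List (List ℕ)) (bn : List (List ℕ))
    (sL : List ℕ → List ℕ) (q' P T : ℕ) (cl w : ℕ) (st : WStateL) : WStateL :=
  let l := runLevelL c q I J D A cap d n₀ gL bn cl (List.zip st.2.1 st.2.2) T
  (((st.1 + w) * q') % P,
    (List.range n₀).map fun k => clampTab c.1 d q (sigTab sL (l.getD (w + (k + 1) * q - 1) ([], [])).1),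
    (List.range n₀).map fun k => clampTab c.1 d q (sigTab sL (l.getD (w + (k + 1) * q - 1) ([], [])).2))

/-- **The walk** on tables: one phase per digit, levels counted along. [cite: Umans2003, §6.3] -/
def walkL (c : ℕ × ℕ × ℕ) (q I J D A cap d n₀ : ℕ) (gL : List (List ℕ) → List (List ℕ)) (bn : List (List ℕ))
    (sL : List ℕ → List ℕ) (q' P T : ℕ) (digits : List ℕ) (st₀ : WStateL) : ℕ × WStateL :=
  digits.foldl (fun cst w => (cst.1 + 1, phaseL c q I J D A cap d n₀ gL bn sL q' P T cst.1 w cst.2)) (0, st₀)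

/-- **The reconstruction** on tables: the `L`-list at window entry `0`, argument `0`, after the walk.
[cite: Umans2003, §6.3] -/
def reconstructL (c : ℕ × ℕ × ℕ) (q I J D A cap d n₀ : ℕ) (gL : List (List ℕ) → List (List ℕ)) (bn : List (List ℕ))
    (sL : List ℕ → List ℕ) (q' P T : ℕ) (digits : List ℕ) (st₀ : WStateL) : List ℕ :=
  (((walkL c q I J D A cap d n₀ gL bn sL q' P T digits st₀).2.2.1.getD 0 []).getD 0 [])

/-! ### Representation -/

section Rep

variable {M : ℕ} {L : Type*} [Field L] [Algebra (GF2 M) L] [DecidableEq L]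
variable {d : ℕ} (X : UmansRec.Ctx (GF2 M) L) (N : Module.Basis (Fin d) (GF2 M) L) (D A : ℕ) (ρ : List ℕ → L)

/-- A table of exactly `q` rows representing a value function. [folklore] -/
def TabOKq (d : ℕ) (ρ : List ℕ → L) (T : Tab) (U : GF2 M → L) : Prop := TabOK d ρ T U ∧ T.length = 2 ^ (M + 1)

/-- A list of table pairs representing a list of value-function pairs, entrywise. [folklore] -/
def PairListOK (d : ℕ) (ρ : List ℕ → L) (l : List (Tab × Tab)) (lm : List ((GF2 M → L) × (GF2 M → L))) : Prop :=
  l.length = lm.length ∧ ∀ (k : ℕ) (hk : k < l.length) (hk' : k < lm.length),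
    TabOKq d ρ (l[k]).1 (lm[k]).1 ∧ TabOKq d ρ (l[k]).2 (lm[k]).2

/-- A list of `n₀` tables representing a window. [folklore] -/
def WinOK (d : ℕ) (ρ : List ℕ → L) {n₀ : ℕ} (Ws : List Tab) (W : Fin n₀ → GF2 M → L) : Prop :=
  Ws.length = n₀ ∧ ∀ k : Fin n₀, TabOKq d ρ (Ws.getD k []) (W k)

/-- A machine state representing a walk state. [folklore] -/
def StateOK (d : ℕ) (ρ : List ℕ → L) {n₀ : ℕ} (st : WStateL) (stm : UmansRec.Ctx.WState (GF2 M) L n₀) : Prop :=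
  st.1 = stm.1 ∧ WinOK d ρ st.2.1 stm.2.1 ∧ WinOK d ρ st.2.2 stm.2.2

/-- **The node lists**: row `e ≤ d` of `bn` lists the bitmasks of the nodes `b(e, k)`, `k < r'`. [folklore] -/
def NodesOK {r' : ℕ} (bn : List (List ℕ)) (b : UmansRec.Idx d r' ↪ GF2 M) : Prop :=
  ∀ (e : ℕ) (he : e < d + 1), (bn.getD e []).length = r' ∧
    ∀ k : Fin r', (bn.getD e []).getD k 0 < 2 ^ (M + 1) ∧ GF2.elt M ((bn.getD e []).getD k 0) = b (⟨e, he⟩, k)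

/-- **A faithful automorphism program**: `sL` represents `X.σ` on representing lists. [folklore] -/
def SigOK (d : ℕ) (X : UmansRec.Ctx (GF2 M) L) (ρ : List ℕ → L) (sL : List ℕ → List ℕ) : Prop :=
  ∀ u : List ℕ, LRep M d u → LRep M d (sL u) ∧ ρ (sL u) = X.σ (ρ u)

variable {X N D A ρ}

/-- `learnL` tables have `q` rows. [folklore] -/
theorem length_learnL (c : ℕ × ℕ × ℕ) (q I J D A cap d : ℕ) (gL : List (List ℕ) → List (List ℕ)) (Ws : List Tab) (nodes : List ℕ)
    (knownLs : List (List ℕ)) : (learnL c q I J D A cap d gL Ws nodes knownLs).length = q := by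
  rw [learnL, List.length_map, List.length_range]

omit [Field L] [Algebra (GF2 M) L] [DecidableEq L] in
/-- Windows as in `WinOK` satisfy the window hypothesis of `learnL_spec`/`stepL_spec`. [folklore] -/
theorem WinOK.tabOK {n₀ : ℕ} {Ws : List Tab} {W : Fin n₀ → GF2 M → L} (h : WinOK d ρ Ws W) :
    ∀ k : Fin n₀, TabOK d ρ (Ws.getD k []) (W k) := fun k => (h.2 k).1

omit [DecidableEq L] in
/-- **The last windows of a represented list** (at least `n₀` entries) represent `lastWindows`. [folklore] -/
theorem lastWinL_ok {l : List (Tab × Tab)} {lm : List ((GF2 M → L) × (GF2 M → L))} (h : PairListOK d ρ l lm) (hn : X.n₀ ≤ l.length) :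
    WinOK d ρ (lastWinL X.n₀ l).1 (X.lastWindows lm).1 ∧ WinOK d ρ (lastWinL X.n₀ l).2 (X.lastWindows lm).2 := by
  obtain ⟨hlen, hent⟩ := h
  have hdl : (l.drop (l.length - X.n₀)).length = X.n₀ := by rw [List.length_drop]; omega
  have hidx : ∀ k : Fin X.n₀, l.length - X.n₀ + (k : ℕ) < l.length := fun k => by have := k.2; omega
  have hget : ∀ k : Fin X.n₀, (l.drop (l.length - X.n₀)).getD k ([], []) = l[l.length - X.n₀ + (k : ℕ)]'(hidx k) := fun k => by
    rw [List.getD_eq_getElem _ _ (by rw [hdl]; exact k.2), List.getElem_drop]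
  have hgetm : ∀ k : Fin X.n₀, lm.getD (lm.length - X.n₀ + (k : ℕ)) (0, 0) = lm[l.length - X.n₀ + (k : ℕ)]'(by rw [← hlen]; exact hidx k) :=
    fun k => by rw [List.getD_eq_getElem _ _ (by rw [← hlen]; exact hidx k)]; simp only [hlen]
  refine ⟨⟨by rw [lastWinL, List.length_map, hdl], fun k => ?_⟩, ⟨by rw [lastWinL, List.length_map, hdl], fun k => ?_⟩⟩
  · rw [lastWinL, UmansRec.Ctx.lastWindows]
    simp only []
    rw [show ([] : Tab) = Prod.fst (([], []) : Tab × Tab) from rfl, List.getD_map, hget k, hgetm k]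
    exact (hent _ (hidx k) (by rw [← hlen]; exact hidx k)).1
  · rw [lastWinL, UmansRec.Ctx.lastWindows]
    simp only []
    rw [show ([] : Tab) = Prod.snd (([], []) : Tab × Tab) from rfl, List.getD_map, hget k, hgetm k]
    exact (hent _ (hidx k) (by rw [← hlen]; exact hidx k)).2

omit [Field L] [Algebra (GF2 M) L] [DecidableEq L] in
/-- Appending represented pairs. [folklore] -/
theorem PairListOK.append {l : List (Tab × Tab)} {lm : List ((GF2 M → L) × (GF2 M → L))} (h : PairListOK d ρ l lm)
    {p : Tab × Tab} {pm : (GF2 M → L) × (GF2 M → L)} (h1 : TabOKq d ρ p.1 pm.1) (h2 : TabOKq d ρ p.2 pm.2) :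
    PairListOK d ρ (l ++ [p]) (lm ++ [pm]) := by
  obtain ⟨hlen, hent⟩ := h
  refine ⟨by rw [List.length_append, List.length_append, hlen, List.length_singleton, List.length_singleton], fun k hk hk' => ?_⟩
  rw [List.length_append, List.length_singleton] at hk
  by_cases hkl : k < l.length
  · rw [List.getElem_append_left hkl, List.getElem_append_left (by rw [← hlen]; exact hkl)]
    exact hent k hkl (by rw [← hlen]; exact hkl)
  · have hk0 : k = l.length := by omega
    subst hk0
    rw [List.getElem_append_right le_rfl, List.getElem_append_right (by rw [hlen])]
    simp only [Nat.sub_self, hlen, List.getElem_cons_zero]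
    exact ⟨h1, h2⟩

/-- The common hypotheses of the representation theorems: faithful coordinates and predictor,
Sudan's numeric hypotheses, `n₀ ≥ 1`, the reference nodes and their lists. [folklore] -/
structure WalkHyps (X : UmansRec.Ctx (GF2 M) L) (N : Module.Basis (Fin d) (GF2 M) L) (D A : ℕ) (ρ : List ℕ → L)
    {r' : ℕ} (b : UmansRec.Idx d r' ↪ GF2 M) (ℓ₀ I J cap : ℕ) (gL : List (List ℕ) → List (List ℕ)) (bn : List (List ℕ)) : Prop where
  hN : CoordOK d N ρ
  hg : PredOK d ℓ₀ X ρ gL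
  hIJ : 2 ^ (M + 1) * ℓ₀ < I * J
  hA : (I - 1) + (J - 1) * D < A
  hcap : J ≤ cap
  hn : 0 < X.n₀
  hbn : NodesOK bn b

variable {r' ℓ₀ I J cap : ℕ} {b : UmansRec.Idx d r' ↪ GF2 M} {gL : List (List ℕ) → List (List ℕ)} {bn : List (List ℕ)}

/-- **One step keeps the representation** (level `cl < d`). [cite: Umans2003, Lemma 17] -/
theorem step_ok (H : WalkHyps X N D A ρ b ℓ₀ I J cap gL bn) {cl : ℕ} (hcl : cl < d)
    {Ws₁ Ws₂ : List Tab} {W₁ W₂ : Fin X.n₀ → GF2 M → L} (h₁ : WinOK d ρ Ws₁ W₁) (h₂ : WinOK d ρ Ws₂ W₂) :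
    let p := stepL (kctx M) (2 ^ (M + 1)) I J D A cap d X.n₀ gL (bn.getD (d - cl) []) (bn.getD 0 []) Ws₁ Ws₂
    let pm := X.step N D A H.hn b cl W₁ W₂
    TabOKq d ρ p.1 pm.1 ∧ TabOKq d ρ p.2 pm.2 := by
  intro p pm
  obtain ⟨hl1, hb1⟩ := H.hbn (d - cl) (by omega)
  obtain ⟨hl0, hb0⟩ := H.hbn 0 (by omega)
  have hb1' : ∀ k : Fin r', (bn.getD (d - cl) []).getD k 0 < 2 ^ (M + 1) ∧
      GF2.elt M ((bn.getD (d - cl) []).getD k 0) = b (UmansRec.lev d cl, k) := fun k => by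
    obtain ⟨h1, h2⟩ := hb1 k; exact ⟨h1, by rw [h2]; rfl⟩
  have hb0' : ∀ k : Fin r', (bn.getD 0 []).getD k 0 < 2 ^ (M + 1) ∧ GF2.elt M ((bn.getD 0 []).getD k 0) = b (0, k) := fun k => by
    obtain ⟨h1, h2⟩ := hb0 k; exact ⟨h1, by rw [h2]; rfl⟩
  obtain ⟨t1, t2⟩ := stepL_spec (X := X) (N := N) (D := D) (A := A) H.hN H.hg H.hIJ H.hA H.hcap H.hn b cl hl1 hl0 hb1' hb0'
    h₁.1 h₂.1 h₁.tabOK h₂.tabOK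
  exact ⟨⟨t1, length_learnL ..⟩, ⟨t2, length_learnL ..⟩⟩

/-- **A level keeps the representation**: from represented initial lists with at least `n₀`
entries, `runLevelL` represents `runLevel`. [cite: Umans2003, §6.3] -/
theorem runLevelL_ok (H : WalkHyps X N D A ρ b ℓ₀ I J cap gL bn) {cl : ℕ} (hcl : cl < d)
    {init : List (Tab × Tab)} {initm : List ((GF2 M → L) × (GF2 M → L))} (h0 : PairListOK d ρ init initm) (hn0 : X.n₀ ≤ init.length) :
    ∀ T : ℕ, PairListOK d ρ (runLevelL (kctx M) (2 ^ (M + 1)) I J D A cap d X.n₀ gL bn cl init T) (X.runLevel N D A H.hn b cl initm T) ∧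
      (runLevelL (kctx M) (2 ^ (M + 1)) I J D A cap d X.n₀ gL bn cl init T).length = init.length + T
  | 0 => ⟨h0, rfl⟩
  | T + 1 => by
    obtain ⟨ih, ihlen⟩ := runLevelL_ok H hcl h0 hn0 T
    rw [runLevelL, List.replicate_succ', List.foldl_append, List.foldl_cons, List.foldl_nil, ← runLevelL, UmansRec.Ctx.runLevel]
    obtain ⟨w1, w2⟩ := lastWinL_ok (X := X) ih (by rw [ihlen]; omega)
    obtain ⟨t1, t2⟩ := step_ok H hcl w1 w2
    exact ⟨ih.append t1 t2, by rw [List.length_append, List.length_singleton, ihlen, Nat.add_assoc]⟩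

omit [DecidableEq L] in
/-- Zipping two represented windows gives a represented initial list. [folklore] -/
theorem zip_ok {Ws₁ Ws₂ : List Tab} {W₁ W₂ : Fin X.n₀ → GF2 M → L} (h₁ : WinOK d ρ Ws₁ W₁) (h₂ : WinOK d ρ Ws₂ W₂) :
    PairListOK d ρ (List.zip Ws₁ Ws₂) (List.ofFn fun k : Fin X.n₀ => (W₁ k, W₂ k)) ∧ (List.zip Ws₁ Ws₂).length = X.n₀ := by
  have hlen : (List.zip Ws₁ Ws₂).length = X.n₀ := by rw [List.length_zip, h₁.1, h₂.1, min_self]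
  refine ⟨⟨by rw [hlen, List.length_ofFn], fun k hk hk' => ?_⟩, hlen⟩
  rw [hlen] at hk
  have e1 := h₁.2 ⟨k, hk⟩
  have e2 := h₂.2 ⟨k, hk⟩
  rw [List.getD_eq_getElem _ _ (by rw [h₁.1]; exact hk)] at e1
  rw [List.getD_eq_getElem _ _ (by rw [h₂.1]; exact hk)] at e2
  simp only [List.getElem_zip, List.getElem_ofFn]
  exact ⟨e1, e2⟩

omit [DecidableEq L] in
/-- `σ` of a represented table. [folklore] -/
theorem sigTab_ok {sL : List ℕ → List ℕ} (hs : SigOK d X ρ sL) {T : Tab} {U : GF2 M → L} (h : TabOKq d ρ T U) :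
    TabOKq d ρ (sigTab sL T) (fun β => X.σ (U β)) := by
  refine ⟨fun bb hbb => ?_, by rw [sigTab, List.length_map, h.2]⟩
  obtain ⟨h1, h2⟩ := h.1 bb hbb
  rw [sigTab, List.getD_eq_getElem _ _ (by rw [List.length_map, h.2]; exact hbb), List.getElem_map,
    ← List.getD_eq_getElem _ [] (by rw [h.2]; exact hbb)]
  obtain ⟨s1, s2⟩ := hs _ h1
  exact ⟨s1, by rw [s2, h2]⟩

omit [Field L] [Algebra (GF2 M) L] [DecidableEq L] in
/-- Clamping is the identity on valid tables. [folklore] -/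
theorem clampTab_ok {T : Tab} {U : GF2 M → L} (h : TabOKq d ρ T U) : TabOKq d ρ (clampTab (M + 2) d (2 ^ (M + 1)) T) U := by
  suffices e : clampTab (M + 2) d (2 ^ (M + 1)) T = T by rw [e]; exact h
  obtain ⟨h1, h2⟩ := h
  rw [clampTab, List.take_of_length_le h2.le]
  conv_rhs => rw [← List.map_id T]
  refine List.map_congr_left fun r hr => ?_
  obtain ⟨k, hk, rfl⟩ := List.getElem_of_mem hr
  rw [h2] at hk
  obtain ⟨⟨hlen, hred⟩, -⟩ := h1 k hk
  rw [List.getD_eq_getElem _ _ (by rw [h2]; exact hk)] at hlen hred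
  rw [id, List.take_of_length_le hlen.le]
  conv_rhs => rw [← List.map_id (T[k])]
  refine List.map_congr_left fun x hx => ?_
  rw [id]
  exact min_eq_left ((hred x hx).le.trans (Nat.pow_le_pow_right two_pos (by omega)))

/-- **A phase keeps the representation** (level `cl < d`, digit `w < q`, enough steps
`(n₀ + 1) q ≤ n₀ + T`). [cite: Umans2003, §6.3] -/
theorem phaseL_ok (H : WalkHyps X N D A ρ b ℓ₀ I J cap gL bn) {sL : List ℕ → List ℕ} (hs : SigOK d X ρ sL) {q' P T : ℕ}
    (hT : (X.n₀ + 1) * 2 ^ (M + 1) ≤ X.n₀ + T) {cl w : ℕ} (hcl : cl < d) (hw : w < 2 ^ (M + 1))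
    {st : WStateL} {stm : UmansRec.Ctx.WState (GF2 M) L X.n₀} (h : StateOK d ρ st stm) :
    StateOK d ρ (phaseL (kctx M) (2 ^ (M + 1)) I J D A cap d X.n₀ gL bn sL q' P T cl w st) (X.phase N D A H.hn b (2 ^ (M + 1)) q' P T cl w stm) := by
  obtain ⟨ha, h₁, h₂⟩ := h
  obtain ⟨hz, hzlen⟩ := zip_ok (X := X) h₁ h₂
  obtain ⟨hl, hllen⟩ := runLevelL_ok H hcl hz (by rw [hzlen]) T
  rw [hzlen] at hllen
  set l := runLevelL (kctx M) (2 ^ (M + 1)) I J D A cap d X.n₀ gL bn cl (List.zip st.2.1 st.2.2) T with hldef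
  set lm := X.runLevel N D A H.hn b cl (List.ofFn fun k : Fin X.n₀ => (stm.2.1 k, stm.2.2 k)) T with hlmdef
  have hidx : ∀ k : Fin X.n₀, w + ((k : ℕ) + 1) * 2 ^ (M + 1) - 1 < X.n₀ + T := by
    intro k
    have h1 : ((k : ℕ) + 1) * 2 ^ (M + 1) ≤ X.n₀ * 2 ^ (M + 1) := Nat.mul_le_mul_right _ (by have := k.2; omega)
    have h3 : (X.n₀ + 1) * 2 ^ (M + 1) = X.n₀ * 2 ^ (M + 1) + 2 ^ (M + 1) := by ring
    generalize hMq : X.n₀ * 2 ^ (M + 1) = Mq at h1 h3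
    omega
  have hpair : ∀ k : Fin X.n₀, TabOKq d ρ (l.getD (w + ((k : ℕ) + 1) * 2 ^ (M + 1) - 1) ([], [])).1 (lm.getD (w + ((k : ℕ) + 1) * 2 ^ (M + 1) - 1) (0, 0)).1 ∧
      TabOKq d ρ (l.getD (w + ((k : ℕ) + 1) * 2 ^ (M + 1) - 1) ([], [])).2 (lm.getD (w + ((k : ℕ) + 1) * 2 ^ (M + 1) - 1) (0, 0)).2 := by
    intro k
    have hk1 : w + ((k : ℕ) + 1) * 2 ^ (M + 1) - 1 < l.length := by rw [hllen]; exact hidx k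
    have hk2 : w + ((k : ℕ) + 1) * 2 ^ (M + 1) - 1 < lm.length := by rw [← hl.1]; exact hk1
    rw [List.getD_eq_getElem _ _ hk1, List.getD_eq_getElem _ _ hk2]
    exact hl.2 _ hk1 hk2
  refine ⟨by rw [phaseL, UmansRec.Ctx.phase, ha], ⟨by rw [phaseL, List.length_map, List.length_range], fun k => ?_⟩,
    ⟨by rw [phaseL, List.length_map, List.length_range], fun k => ?_⟩⟩
  · rw [phaseL, UmansRec.Ctx.phase]
    simp only []
    rw [List.getD_eq_getElem _ _ (by rw [List.length_map, List.length_range]; exact k.2), List.getElem_map, List.getElem_range]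
    exact clampTab_ok (sigTab_ok hs (hpair k).1)
  · rw [phaseL, UmansRec.Ctx.phase]
    simp only []
    rw [List.getD_eq_getElem _ _ (by rw [List.length_map, List.length_range]; exact k.2), List.getElem_map, List.getElem_range]
    exact clampTab_ok (sigTab_ok hs (hpair k).2)

omit [DecidableEq L] in
/-- The walk reads only the digits below the number of phases. [folklore] -/
theorem walk_congr (hn : 0 < X.n₀) (bb : UmansRec.Idx d r' ↪ GF2 M) (q q' P T : ℕ) {w w' : ℕ → ℕ} (st₀ : UmansRec.Ctx.WState (GF2 M) L X.n₀) :
    ∀ c : ℕ, (∀ c', c' < c → w c' = w' c') → X.walk N D A hn bb q q' P T w st₀ c = X.walk N D A hn bb q q' P T w' st₀ c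
  | 0, _ => rfl
  | c + 1, h => by
    rw [UmansRec.Ctx.walk, UmansRec.Ctx.walk, walk_congr hn bb q q' P T st₀ c fun c' hc' => h c' (Nat.lt_succ_of_lt hc'),
      h c (Nat.lt_succ_self c)]

/-- **The walk keeps the representation**: after the digits `digits` (all `< q`, at most `d` of
them) the machine state represents the walk with digit function `c ↦ digits[c]`, and the level
counter is `|digits|`. [cite: Umans2003, §6.3] -/
theorem walkL_ok (H : WalkHyps X N D A ρ b ℓ₀ I J cap gL bn) {sL : List ℕ → List ℕ} (hs : SigOK d X ρ sL) {q' P T : ℕ}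
    (hT : (X.n₀ + 1) * 2 ^ (M + 1) ≤ X.n₀ + T) {st₀ : WStateL} {stm₀ : UmansRec.Ctx.WState (GF2 M) L X.n₀} (h0 : StateOK d ρ st₀ stm₀) :
    ∀ digits : List ℕ, (∀ w ∈ digits, w < 2 ^ (M + 1)) → digits.length ≤ d →
      (walkL (kctx M) (2 ^ (M + 1)) I J D A cap d X.n₀ gL bn sL q' P T digits st₀).1 = digits.length ∧
      StateOK d ρ (walkL (kctx M) (2 ^ (M + 1)) I J D A cap d X.n₀ gL bn sL q' P T digits st₀).2
        (X.walk N D A H.hn b (2 ^ (M + 1)) q' P T (fun c => digits.getD c 0) stm₀ digits.length) := by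
  intro digits
  induction digits using List.reverseRecOn with
  | nil => intro _ _; exact ⟨rfl, h0⟩
  | append_singleton ds w ih =>
    intro hds hlen
    rw [List.length_append, List.length_singleton] at hlen
    obtain ⟨ih1, ih2⟩ := ih (fun x hx => hds x (List.mem_append_left _ hx)) (by omega)
    rw [walkL, List.foldl_append, List.foldl_cons, List.foldl_nil, ← walkL, List.length_append, List.length_singleton,
      UmansRec.Ctx.walk]
    refine ⟨by rw [ih1], ?_⟩
    simp only [ih1]
    have hw : w < 2 ^ (M + 1) := hds w (List.mem_append_right _ (List.mem_singleton_self w))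
    have hdig : (ds ++ [w]).getD ds.length 0 = w := by
      rw [List.getD_append_right _ _ _ _ le_rfl, Nat.sub_self, List.getD_cons_zero]
    rw [hdig, walk_congr (X := X) (N := N) (D := D) (A := A) H.hn b (2 ^ (M + 1)) q' P T stm₀ ds.length (w := fun c => (ds ++ [w]).getD c 0)
      (w' := fun c => ds.getD c 0) fun c' hc' => List.getD_append _ _ _ _ hc']
    exact phaseL_ok H hs hT (by omega) hw ih2

/-- **The reconstruction is represented**: after `d` digits, `ρ (reconstructL …) = X.reconstruct …`
and the output is a representing list. [cite: Umans2003, §6.3] -/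
theorem reconstructL_ok (H : WalkHyps X N D A ρ b ℓ₀ I J cap gL bn) {sL : List ℕ → List ℕ} (hs : SigOK d X ρ sL) {q' P T : ℕ}
    (hT : (X.n₀ + 1) * 2 ^ (M + 1) ≤ X.n₀ + T) {st₀ : WStateL} {stm₀ : UmansRec.Ctx.WState (GF2 M) L X.n₀} (h0 : StateOK d ρ st₀ stm₀)
    {digits : List ℕ} (hds : ∀ w ∈ digits, w < 2 ^ (M + 1)) (hlen : digits.length = d) :
    LRep M d (reconstructL (kctx M) (2 ^ (M + 1)) I J D A cap d X.n₀ gL bn sL q' P T digits st₀) ∧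
      ρ (reconstructL (kctx M) (2 ^ (M + 1)) I J D A cap d X.n₀ gL bn sL q' P T digits st₀) =
        X.reconstruct N D A H.hn b (2 ^ (M + 1)) q' P T (fun c => digits.getD c 0) stm₀ := by
  subst hlen
  obtain ⟨-, -, hW, -⟩ := walkL_ok (q' := q') (P := P) H hs hT h0 digits hds le_rfl
  obtain ⟨-, hk⟩ := hW
  obtain ⟨h1, -⟩ := hk ⟨0, H.hn⟩
  obtain ⟨r1, r2⟩ := h1 0 (Nat.two_pow_pos _)
  rw [GF2.elt, bitsPoly_zero, map_zero] at r2
  exact ⟨r1, r2⟩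

end Rep

end UmansFP

end Literature.Computability.Complexity

end
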